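import Mathlib.Algebra.BigOperators.Ring.Finset
import Mathlib.Algebra.Order.BigOperators.Group.Finset
import Mathlib.Data.Real.Basic
import Mathlib.Data.Fintype.BigOperators
import Mathlib.Tactic.Linarith
import Mathlib.Tactic.Ring
import Mathlib.Tactic.Positivity
import Mathlib.Tactic.FieldSimp
import HarnessLib

/-!
# Impagliazzo's hard-core lemma, constructive (boosting) form

Topic `Computability/Complexity`. Impagliazzo's hard-core lemma (Impagliazzo, FOCS 1995; Arora–Barak
2009, Lemma 19.3) says that a function `f : {0,1}ⁿ → {0,1}` that no small circuit computes on more than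
a `1 - δ` fraction of the inputs has a "hard-core" measure of density `δ` on which no (somewhat
smaller) circuit has advantage `ε` over guessing. **Taken in the contrapositive** (Arora–Barak 2009,
§19.1.2, the remark after the proof of Lemma 19.3): *if for every measure of density `δ` some predictor
of the class has a non-trivial advantage, then a majority vote of boundedly many predictors of the
class computes `f` on all but a `δ` fraction of the inputs* — the boosting form, which is what
hardness-amplification proofs consume (Healy–Vadhan–Viola 2006; Hirahara CCC 2020, App. A, Lemma 74,
the step used in the tree's formalisation of Hirahara's FOCS 2022 Lemma 8.1).

This file PROVES the boosting form by the constructive iterative argument ("Impagliazzo's original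
proof was constructive", loc. cit.; cf. Klivans–Servedio, *Boosting and hard-core set construction*,
Machine Learning 51 (2003)), entirely combinatorially — no min-max theorem:

* predictors are arbitrary Boolean functions on a finite universe `U`; a class is a set `Cls` of them;
* measures are INTEGER-capped weights `M : U → ℤ`, `0 ≤ M x ≤ K`, of density `δ` when
  `∑ M ≥ δ K |U|`; the advantage hypothesis is `∑ₓ M(x) σ_P(x) ≥ γ ∑ₓ M(x)` with
  `σ_P(x) = +1` if `P x = f x` and `-1` otherwise (`HardCore.sgn`);
* `HardCore.exists_majority_correct` — **the lemma**: if `K γ δ ≥ 2` and every capped measure of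
  density `δ` admits a predictor `P ∈ Cls` with advantage `γ`, then there are `T ≤ K²` predictors
  `P₀, …, P_{T-1} ∈ Cls` whose vote margin `R_T = ∑ⱼ σ_{Pⱼ}` is `≤ 0` (majority not correct) on fewer
  than `δ |U|` points.

**Proof.** Build `P₀, P₁, …` greedily: with `R_T(x) = ∑_{j < T} σ_{Pⱼ}(x)` take the measure
`M_T(x) = w(R_T(x))`, `w(r) = min(K, max(0, K - r))`, and as long as `∑ M_T ≥ δ K |U|` pick `P_T`
with advantage `γ` on `M_T`. Each round contributes `≥ γ δ K |U|` to `A_T = ∑_{j<T} ∑ₓ M_j(x) σⱼ(x)`,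
while for each `x` the discrete integration-by-parts bound
`∑_{j<T} w(R_j) (R_{j+1} - R_j) ≤ G(R_T) + T ≤ K² + T` holds (`G` the discrete antiderivative of `w`
with `G(0) = 0`; an up-step is exact, a down-step errs by `w(r-1) - w(r) ≤ 1`;
`HardCore.sum_weight_mul_sgn_le`). Hence `T (γ δ K - 1) ≤ K²`, so with `γ δ K ≥ 2` the density
drops below `δ` at some `T ≤ K²`; at the first such `T` all earlier rounds used predictors from `Cls`,
and the points with `R_T(x) ≤ 0` all carry weight `K`, so there are fewer than `δ |U|` of them.

## References

* S. Arora, B. Barak, *Computational Complexity: A Modern Approach*, CUP 2009, §19.1, Lemma 19.3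
  (Impagliazzo's hardcore lemma, density-`δ` distributions) and §19.1.2 (its proof and the remark
  on the contrapositive/boosting form and Impagliazzo's constructive proof) [AroraBarak2009]
  (read via `lit read book:arora2009-computational-complexity-modern-approach`, chunks p0442–p0445).
* R. Impagliazzo, *Hard-core distributions for somewhat hard problems*, FOCS 1995, 538–545.
* A. R. Klivans, R. A. Servedio, *Boosting and hard-core set construction*, Machine Learning 51
  (2003) 217–238.
* S. Hirahara, *Non-disjoint promise problems from meta-computational view of pseudorandom generator
  constructions*, CCC 2020, App. A, Lemma 74 (the consumer).
-/

namespace Literature.Computability.Complexity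

open Finset

namespace HardCore

variable {U : Type*} [Fintype U]

/-! ### Signs, vote margins, capped weights -/

/-- The correctness sign `σ_P(x) = +1` if `P x = f x`, `-1` otherwise. [cite: AroraBarak2009, §19.1.2] -/
def sgn (f P : U → Bool) (x : U) : ℤ := if P x = f x then 1 else -1

omit [Fintype U] in
/-- A sign is `±1`. [folklore] -/
theorem sgn_eq_or (f P : U → Bool) (x : U) : sgn f P x = 1 ∨ sgn f P x = -1 := by
  unfold sgn; split_ifs <;> simp

/-- The vote margin `R_T(x) = ∑_{j<T} σ_{Pⱼ}(x)` of the first `T` predictors of a sequence (the strict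
majority of `P₀ x, …, P_{T-1} x` is `f x` iff `R_T(x) > 0`). [cite: AroraBarak2009, §19.1.2 (majority of C₁,…,C_t)] -/
def margin (f : U → Bool) (P : ℕ → U → Bool) (T : ℕ) (x : U) : ℤ := ∑ j ∈ range T, sgn f (P j) x

omit [Fintype U] in
/-- `R_{T+1} = R_T + σ_T`. [folklore] -/
theorem margin_succ (f : U → Bool) (P : ℕ → U → Bool) (T : ℕ) (x : U) :
    margin f P (T + 1) x = margin f P T x + sgn f (P T) x := by
  rw [margin, sum_range_succ]; rfl

omit [Fintype U] in
/-- The margin up to `T` only depends on the first `T` predictors. [folklore] -/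
theorem margin_congr (f : U → Bool) {P P' : ℕ → U → Bool} {T : ℕ} (h : ∀ j < T, P j = P' j) (x : U) :
    margin f P T x = margin f P' T x :=
  sum_congr rfl fun j hj => by rw [h j (mem_range.1 hj)]

/-- The capped weight `w(r) = min(K, max(0, K - r))`: `K` for `r ≤ 0`, `K - r` for `0 ≤ r ≤ K`,
`0` for `r ≥ K`. [cite: AroraBarak2009, §19.1.2 (Impagliazzo's constructive proof)] -/
def weight (K : ℕ) (r : ℤ) : ℤ := min K (max 0 (K - r))

/-- `0 ≤ w`. [folklore] -/
theorem weight_nonneg (K : ℕ) (r : ℤ) : 0 ≤ weight K r := by unfold weight; omega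

/-- `w ≤ K`. [folklore] -/
theorem weight_le (K : ℕ) (r : ℤ) : weight K r ≤ K := by unfold weight; omega

/-- `w(r) = K` for `r ≤ 0`. [folklore] -/
theorem weight_of_nonpos (K : ℕ) {r : ℤ} (hr : r ≤ 0) : weight K r = K := by unfold weight; omega

/-- A down-step changes the weight by at most `1`. [folklore] -/
theorem weight_sub_one_le (K : ℕ) (r : ℤ) : weight K (r - 1) ≤ weight K r + 1 := by
  unfold weight; omega

/-- The discrete antiderivative `G` of `w` with `G(0) = 0`: `G(r) = ∑_{0 ≤ s < r} w(s)` for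
`r ≥ 0` and `G(r) = K r` for `r < 0` (where `w ≡ K`). [folklore] -/
def anti (K : ℕ) (r : ℤ) : ℤ :=
  if r < 0 then K * r else ∑ s ∈ range r.toNat, weight K s

/-- `G(r + 1) = G(r) + w(r)`. [folklore] -/
theorem anti_add_one (K : ℕ) (r : ℤ) : anti K (r + 1) = anti K r + weight K r := by
  unfold anti
  rcases lt_trichotomy r (-1) with h | rfl | h
  · rw [if_pos (by omega), if_pos (by omega), weight_of_nonpos K (by omega)]; ring
  · norm_num [weight_of_nonpos K (show (-1 : ℤ) ≤ 0 by norm_num)]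
  · rw [if_neg (by omega), if_neg (by omega)]
    have hr : 0 ≤ r := by omega
    have : (r + 1).toNat = r.toNat + 1 := by omega
    rw [this, sum_range_succ, Int.toNat_of_nonneg hr]

/-- `G(r) ≤ K²` (`w` vanishes from `K` on, and `G ≤ 0` on the negatives). [folklore] -/
theorem anti_le (K : ℕ) (r : ℤ) : anti K r ≤ (K : ℤ) ^ 2 := by
  unfold anti
  split_ifs with h
  · nlinarith
  · calc ∑ s ∈ range r.toNat, weight K s
        ≤ ∑ s ∈ range r.toNat, if s < K then (K : ℤ) else 0 :=
          sum_le_sum fun s _ => by unfold weight; split_ifs <;> omega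
      _ = (((range r.toNat).filter fun s => s < K).card : ℤ) * K := by
          rw [← sum_filter, sum_const, nsmul_eq_mul]
      _ ≤ (K : ℤ) * K := by
          have hsub : ((range r.toNat).filter fun s => s < K) ⊆ range K := fun s hs => by
            rw [mem_filter, mem_range] at hs; exact mem_range.2 hs.2
          have hc : ((range r.toNat).filter fun s => s < K).card ≤ K :=
            (card_le_card hsub).trans (card_range K).le
          have hK : (0 : ℤ) ≤ K := Nat.cast_nonneg K
          exact mul_le_mul_of_nonneg_right (by exact_mod_cast hc) hK
      _ = (K : ℤ) ^ 2 := by ring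

omit [Fintype U] in
/-- **Discrete integration by parts.** Along the `±1` walk `R₀ = 0, R₁, …` of vote margins,
`∑_{j<T} w(R_j) σⱼ ≤ G(R_T) + T`: an up-step is exact (`G(r+1) - G(r) = w(r)`), a down-step loses at
most `w(r-1) - w(r) ≤ 1`. [cite: AroraBarak2009, §19.1.2 (Impagliazzo's constructive proof; potential argument)] -/
theorem sum_weight_mul_sgn_le (K : ℕ) (f : U → Bool) (P : ℕ → U → Bool) (x : U) : ∀ T : ℕ,
    ∑ j ∈ range T, weight K (margin f P j x) * sgn f (P j) x ≤ anti K (margin f P T x) + T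
  | 0 => by simp [margin, anti]
  | T + 1 => by
    rw [sum_range_succ, margin_succ]
    have ih := sum_weight_mul_sgn_le K f P x T
    set R := margin f P T x
    rcases sgn_eq_or f (P T) x with h | h <;> rw [h]
    · rw [anti_add_one]; push_cast; linarith
    · have h1 := anti_add_one K (R - 1)
      rw [sub_add_cancel] at h1
      have h2 := weight_sub_one_le K R
      rw [show R + -1 = R - 1 by ring]; push_cast; linarith

/-! ### The measures of the iteration and the potential bound -/

/-- The capped measure `M_T(x) = w(R_T(x))` after `T` rounds. [cite: AroraBarak2009, §19.1.2] -/
def measure (K : ℕ) (f : U → Bool) (P : ℕ → U → Bool) (T : ℕ) (x : U) : ℤ :=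
  weight K (margin f P T x)

/-- The advantage of a predictor `Q` on a measure `M`: `∑ₓ M(x) σ_Q(x)`. [cite: AroraBarak2009, §19.1.2] -/
def advOn (f : U → Bool) (M : U → ℤ) (Q : U → Bool) : ℤ := ∑ x, M x * sgn f Q x

/-- The total weight `∑ₓ M(x)` of a measure. [cite: AroraBarak2009, Lemma 19.3 (density)] -/
def mass (M : U → ℤ) : ℤ := ∑ x, M x

/-- **Potential bound**: `∑_{j<T} adv(M_j, P_j) ≤ |U| (K² + T)`. [cite: AroraBarak2009, §19.1.2 (Impagliazzo's constructive proof)] -/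
theorem sum_advOn_le (K : ℕ) (f : U → Bool) (P : ℕ → U → Bool) (T : ℕ) :
    ∑ j ∈ range T, advOn f (measure K f P j) (P j) ≤ Fintype.card U * ((K : ℤ) ^ 2 + T) := by
  unfold advOn measure
  rw [sum_comm]
  calc ∑ x, ∑ j ∈ range T, weight K (margin f P j x) * sgn f (P j) x
      ≤ ∑ _x : U, ((K : ℤ) ^ 2 + T) := sum_le_sum fun x _ =>
        (sum_weight_mul_sgn_le K f P x T).trans (add_le_add (anti_le K _) le_rfl)
    _ = Fintype.card U * ((K : ℤ) ^ 2 + T) := by rw [sum_const, card_univ, nsmul_eq_mul]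

/-! ### The greedy sequence -/

section Greedy

variable (K : ℕ) (γ δ : ℝ) (f : U → Bool) (Cls : Set (U → Bool))

/-- A measure `M` is **dense**: `∑ M ≥ δ K |U|`. [cite: AroraBarak2009, Lemma 19.3 (density-δ distributions)] -/
def Dense (M : U → ℤ) : Prop := δ * K * Fintype.card U ≤ (mass M : ℝ)

/-- `Q` is a **weak predictor** on `M`: it lies in the class and `∑ M σ_Q ≥ γ ∑ M`.
[cite: AroraBarak2009, §19.1.2 ("for every δ-density distribution … a circuit with advantage")] -/
def Weak (M : U → ℤ) (Q : U → Bool) : Prop := Q ∈ Cls ∧ γ * (mass M : ℝ) ≤ (advOn f M Q : ℝ)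

/-- A predictor sequence is **greedy up to `T`**: at every round `j < T` at which the current measure
is dense, the predictor used is a weak predictor for it. [cite: AroraBarak2009, §19.1.2 (Impagliazzo's constructive proof)] -/
def Greedy (P : ℕ → U → Bool) (T : ℕ) : Prop :=
  ∀ j < T, Dense K δ (measure K f P j) → Weak γ f Cls (measure K f P j) (P j)

variable {K γ δ f Cls}

omit [Fintype U] in
/-- The measures of the iteration are capped. [folklore] -/
theorem measure_capped (P : ℕ → U → Bool) (T : ℕ) (x : U) :
    0 ≤ measure K f P T x ∧ measure K f P T x ≤ K :=
  ⟨weight_nonneg _ _, weight_le _ _⟩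

/-- **Greedy sequences exist** for every horizon (extend round by round, using the hypothesis when the
current measure is dense). [cite: AroraBarak2009, §19.1.2 (Impagliazzo's constructive proof)] -/
theorem exists_greedy
    (hyp : ∀ M : U → ℤ, (∀ x, 0 ≤ M x ∧ M x ≤ K) → Dense K δ M → ∃ Q, Weak γ f Cls M Q) :
    ∀ T : ℕ, ∃ P : ℕ → U → Bool, Greedy K γ δ f Cls P T
  | 0 => ⟨fun _ => f, fun j hj => absurd hj (Nat.not_lt_zero _)⟩
  | T + 1 => by
    obtain ⟨P, hP⟩ := exists_greedy hyp T
    -- the predictor for round `T`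
    have hQ : ∃ Q : U → Bool, Dense K δ (measure K f P T) → Weak γ f Cls (measure K f P T) Q := by
      by_cases hd : Dense K δ (measure K f P T)
      · obtain ⟨Q, hQ⟩ := hyp _ (measure_capped P T) hd
        exact ⟨Q, fun _ => hQ⟩
      · exact ⟨f, fun h => absurd h hd⟩
    obtain ⟨Q, hQ⟩ := hQ
    set P' : ℕ → U → Bool := fun j => if j < T then P j else Q with hP'
    have hagree : ∀ S ≤ T, ∀ j < S, P' j = P j := fun S hS j hj => by
      rw [hP']; simp only; rw [if_pos (by omega)]
    have hmeas : ∀ S ≤ T, measure K f P' S = measure K f P S := fun S hS => by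
      funext x
      unfold measure
      rw [margin_congr f (hagree S hS)]
    refine ⟨P', fun j hj hd => ?_⟩
    rcases Nat.lt_succ_iff_lt_or_eq.1 hj with hjT | rfl
    · rw [hmeas j hjT.le] at hd ⊢
      rw [hagree T le_rfl j hjT]
      exact hP j hjT hd
    · rw [hmeas j le_rfl] at hd ⊢
      have : P' j = Q := by rw [hP']; simp
      rw [this]
      exact hQ hd

/-- **Rounds cannot all be dense**: if the first `T` measures of a greedy sequence are all dense then
`T (γ δ K - 1) ≤ K²` (each round contributes `≥ γ δ K |U|` to the potential `≤ |U|(K² + T)`).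
[cite: AroraBarak2009, §19.1.2 (Impagliazzo's constructive proof)] -/
theorem dense_rounds_le [Nonempty U] (hγ : 0 ≤ γ) {P : ℕ → U → Bool} {T : ℕ}
    (hP : Greedy K γ δ f Cls P T) (hdense : ∀ j < T, Dense K δ (measure K f P j)) :
    (T : ℝ) * (γ * δ * K - 1) ≤ (K : ℝ) ^ 2 := by
  have hU : (0 : ℝ) < Fintype.card U := by exact_mod_cast Fintype.card_pos
  -- lower bound on the potential
  have hlow : ∀ j < T, γ * δ * K * Fintype.card U ≤ (advOn f (measure K f P j) (P j) : ℝ) := by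
    intro j hj
    have hw := (hP j hj (hdense j hj)).2
    have hd := hdense j hj
    unfold Dense at hd
    calc γ * δ * K * Fintype.card U = γ * (δ * K * Fintype.card U) := by ring
      _ ≤ γ * (mass (measure K f P j) : ℝ) := mul_le_mul_of_nonneg_left hd hγ
      _ ≤ _ := hw
  have hsum : (T : ℝ) * (γ * δ * K * Fintype.card U) ≤
      ((∑ j ∈ range T, advOn f (measure K f P j) (P j) : ℤ) : ℝ) := by
    push_cast
    calc (T : ℝ) * (γ * δ * K * Fintype.card U) = ∑ _j ∈ range T, γ * δ * K * Fintype.card U := by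
          rw [sum_const, card_range, nsmul_eq_mul]
      _ ≤ ∑ j ∈ range T, (advOn f (measure K f P j) (P j) : ℝ) :=
          sum_le_sum fun j hj => hlow j (mem_range.1 hj)
  have hup : ((∑ j ∈ range T, advOn f (measure K f P j) (P j) : ℤ) : ℝ) ≤
      Fintype.card U * ((K : ℝ) ^ 2 + T) := by
    exact_mod_cast sum_advOn_le K f P T
  have h := hsum.trans hup
  -- divide by `|U| > 0`
  have h' : (T : ℝ) * (γ * δ * K) ≤ (K : ℝ) ^ 2 + T := by
    have := div_le_div_of_nonneg_right h hU.le
    rw [show (T : ℝ) * (γ * δ * K * Fintype.card U) / Fintype.card U = T * (γ * δ * K) by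
      field_simp, show (Fintype.card U : ℝ) * ((K : ℝ) ^ 2 + T) / Fintype.card U = (K : ℝ) ^ 2 + T by
      field_simp] at this
    exact this
  linarith

end Greedy

/-! ### The lemma -/

/-- **Impagliazzo's hard-core lemma, boosting form** (Arora–Barak 2009, Lemma 19.3 in the
contrapositive; Impagliazzo 1995). Let `f : U → {0,1}` on a finite nonempty universe, `Cls` a class of
predictors, `K` an integer cap and `γ ≥ 0`, `δ` reals with `K γ δ ≥ 2`. If every capped measure
`M : U → [0, K] ∩ ℤ` of density `δ` (`∑ M ≥ δ K |U|`) admits `P ∈ Cls` with advantage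
`∑ₓ M(x) σ_P(x) ≥ γ ∑ₓ M(x)`, then there are `T ≤ K²` predictors `P₀, …, P_{T-1} ∈ Cls` whose vote
margin `∑ⱼ σ_{Pⱼ}(x)` is `≤ 0` on fewer than `δ |U|` points `x` — so their majority computes `f` on
more than a `1 - δ` fraction of `U`. [cite: AroraBarak2009, §19.1.2 (Lemma 19.3, contrapositive; "Impagliazzo's original proof was constructive")] -/
theorem exists_majority_correct [Nonempty U] {K : ℕ} {γ δ : ℝ} (hγ : 0 ≤ γ)
    (hKγδ : 2 ≤ K * γ * δ) {f : U → Bool} {Cls : Set (U → Bool)}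
    (hyp : ∀ M : U → ℤ, (∀ x, 0 ≤ M x ∧ M x ≤ K) → Dense K δ M → ∃ Q, Weak γ f Cls M Q) :
    ∃ (T : ℕ) (P : ℕ → U → Bool), T ≤ K ^ 2 ∧ (∀ j < T, P j ∈ Cls) ∧
      (((univ : Finset U).filter fun x => margin f P T x ≤ 0).card : ℝ) < δ * Fintype.card U := by
  obtain ⟨P, hP⟩ := exists_greedy hyp (K ^ 2 + 1)
  -- some round `≤ K²` is not dense
  have hex : ∃ T, T ≤ K ^ 2 ∧ ¬Dense K δ (measure K f P T) := by
    by_contra hcon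
    have hall : ∀ j < K ^ 2 + 1, Dense K δ (measure K f P j) := fun j hj => by
      by_contra hj'
      exact hcon ⟨j, by omega, hj'⟩
    have h := dense_rounds_le hγ hP hall
    have hK1 : (1 : ℝ) ≤ γ * δ * K - 1 := by nlinarith
    have : ((K ^ 2 + 1 : ℕ) : ℝ) * 1 ≤ (K : ℝ) ^ 2 := by
      calc ((K ^ 2 + 1 : ℕ) : ℝ) * 1 ≤ ((K ^ 2 + 1 : ℕ) : ℝ) * (γ * δ * K - 1) :=
            mul_le_mul_of_nonneg_left hK1 (by positivity)
        _ ≤ (K : ℝ) ^ 2 := h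
    push_cast at this
    linarith
  -- take the first such round
  classical
  let T := Nat.find hex
  obtain ⟨hT, hTd⟩ : T ≤ K ^ 2 ∧ ¬Dense K δ (measure K f P T) := Nat.find_spec hex
  have hbefore : ∀ j < T, Dense K δ (measure K f P j) := fun j hj => by
    by_contra hj'
    exact Nat.find_min hex hj ⟨(le_of_lt hj).trans hT, hj'⟩
  refine ⟨T, P, hT, fun j hj => (hP j (by omega) (hbefore j hj)).1, ?_⟩
  -- the points with nonpositive margin carry weight `K` each
  unfold Dense at hTd
  rw [not_le] at hTd
  have hK : (0 : ℝ) < K := by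
    have : (0 : ℝ) < K * γ * δ := by linarith
    rcases Nat.eq_zero_or_pos K with rfl | hK
    · simp at this
    · exact_mod_cast hK
  have hcount : (K : ℤ) * ((univ : Finset U).filter fun x => margin f P T x ≤ 0).card ≤
      mass (measure K f P T) := by
    unfold mass measure
    calc (K : ℤ) * ((univ : Finset U).filter fun x => margin f P T x ≤ 0).card
        = ∑ x ∈ (univ : Finset U).filter (fun x => margin f P T x ≤ 0), (K : ℤ) := by
          rw [sum_const, nsmul_eq_mul, mul_comm]
      _ = ∑ x ∈ (univ : Finset U).filter (fun x => margin f P T x ≤ 0),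
            weight K (margin f P T x) :=
          sum_congr rfl fun x hx => (weight_of_nonpos K (mem_filter.1 hx).2).symm
      _ ≤ ∑ x, weight K (margin f P T x) :=
          sum_le_sum_of_subset_of_nonneg (filter_subset _ _) fun x _ _ => weight_nonneg K _
  have hcountR : (K : ℝ) * ((univ : Finset U).filter fun x => margin f P T x ≤ 0).card ≤
      (mass (measure K f P T) : ℝ) := by exact_mod_cast hcount
  have h := hcountR.trans_lt hTd
  -- divide by `K > 0`
  have h' : (K : ℝ) * ((univ : Finset U).filter fun x => margin f P T x ≤ 0).card <
      K * (δ * Fintype.card U) := by linarith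
  exact lt_of_mul_lt_mul_left h' hK.le

end HardCore

end Literature.Computability.Complexity
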